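import Literature.NumberTheory.GaloisRepresentations.ModPGaloisRepKummerProofs
import Literature.NumberTheory.GaloisRepresentations.SerreWeight
import Mathlib.RingTheory.RootsOfUnity.Lemmas
import HarnessLib

/-!
# The level-one fundamental character is the cyclotomic character when `e = 1`
# (Serre 1972, §1.8, Prop. 8), and the Kummer character of inertia only sees valuations

`Proofs` file (theorems only: no definition, no named fact, no `sorry`), topic
`NumberTheory/GaloisRepresentations`, sibling of `ModPGaloisRepKummerProofs` and
`TameInertiaCharacterProofs`.

J.-P. Serre, *Propriétés galoisiennes des points d'ordre fini des courbes elliptiques*, Invent.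
Math. 15 (1972), §1.8: *"Soit `χ` le caractère de `G` donnant l'action de `G` sur les racines
`p`-ièmes de l'unité … Prop. 8 — `θ_{p-1} = χ^e` (restriction à `I`). Cor. — Si `e = 1`, on a
`θ_{p-1} = χ`."*  Here `θ_{p-1}` is the character of the tame inertia on the `(p-1)`-th roots of
a uniformiser; for `F` with residue field `𝔽_p` it is the tree's level-one fundamental character
`fundamentalCharacter F 1 ι ϖ hϖ` (item C15), and `χ` restricted to `I_F = absInertia F` is the
tree's `modPCyclotomicCharacter`.  We prove the Corollary (`e = 1`: `p` is a uniformiser of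
`𝒪[F]`, as recorded in a `LocalRestrictionAt` datum, `irreducible_natCast`, together with
`residueFieldCard_eq`):

* `coe_fundamentalCharacter_one_eq_modPCyclotomicCharacter` — for `σ ∈ I_F`,
  `ψ₁(σ) = χ̄_p(σ)` in `k` (both pushed into `k`, along `ι : S ⧸ 𝔓 → k` and `ι' : 𝔽_p → k`);
* `LocalRestrictionAt.coe_fundamentalCharacter_one_eq_modPCyclotomicCharacter` — the same at a
  local restriction datum of a global `ρ̄`.

Serre's proof: `θ_{p-1}` is computed on `(-p)^{1/(p-1)}`, and `ℚ_p((-p)^{1/(p-1)}) = ℚ_p(μ_p)`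
with `σ(ζ - 1)/(ζ - 1) ≡ χ(σ) (mod 𝔓)`.  We organise it through the elementary principle behind
§1.7 Prop. 3 / §1.8 (the action of `I` on `x^{1/d}` modulo `𝔓` only depends on `v(x)`):

* `residue_smul_div_eq_of_algNorm_eq` — for `σ ∈ I_F` and `z₁, z₂ ∈ F̄ˣ` **of the same absolute
  value**, `σ(z₁)/z₁ ≡ σ(z₂)/z₂ (mod 𝔓)` (`w = z₁/z₂` is a unit of `S` and `σ(w) ≡ w`);
* `coe_kummerCharacter_eq_residue_smul_div` — hence the Kummer character `θ` of `a` at `σ ∈ I_F`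
  is `σ(z)/z mod 𝔓` for *any* `z ∈ F̄ˣ` with `‖z‖ ^ n = ‖a‖`, not only for the chosen root;
* `algNorm_one_sub_pow_eq` / `algNorm_one_sub_primitiveRoot_pow` — for a primitive `p`-th root of
  unity `ζ` (`p` the residue characteristic, a uniformiser): `‖1 - ζ^j‖ = ‖1 - ζ‖` for `p ∤ j` and
  `‖1 - ζ‖^{p-1} = ‖p‖` (from `∏_{0<j<p} (1 - ζ^j) = p`, Mathlib
  `IsPrimitiveRoot.prod_one_sub_pow_eq_order`), so `ζ ≡ 1 (mod 𝔓)` and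
  `σ(ζ - 1)/(ζ - 1) = 1 + ζ + ⋯ + ζ^{a-1} ≡ a (mod 𝔓)` when `σ ζ = ζ^a`
  (`residue_smul_sub_one_div`).

## References

* [SerreInventiones1972] J.-P. Serre, Invent. Math. 15 (1972) 259–331, §1.3 (Prop. 1–2), §1.7
  (Prop. 3), §1.8 (Prop. 8 and Cor.).
* [Serre1987] J.-P. Serre, Duke Math. J. 54 (1987), §1.4 (`χ`), §2.1 (`χ = ψ₁` pour `ℚ_p`:
  "le caractère fondamental de niveau 1 n'est autre que (la restriction à `I` de) le caractère
  cyclotomique `χ`").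
* [NeukirchANT1999] J. Neukirch, *Algebraic Number Theory*, Ch. II (4.8), (7.13) (`(1-ζ)` is a
  uniformiser of `ℚ_p(ζ_p)`, `(1 - ζ)^{p-1} ~ p`).
-/

noncomputable section

open scoped Valued
open Field ValuativeRel Finset

namespace Literature.NumberTheory.GaloisRepresentations

open GaloisRepresentations.IsNonarchimedeanLocalField

universe u v

variable {F : Type u} [Field F] [ValuativeRel F] [TopologicalSpace F] [IsNonarchimedeanLocalField F]

/-! ### The action of inertia on `x^{1/d}` modulo `𝔓` only depends on `‖x‖` -/

section Valuation

/-- For `σ ∈ Γ_F` and `z ≠ 0`, `‖σ(z)/z‖ = 1` (`Γ_F` acts by isometries). [folklore] -/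
theorem algNorm_smul_div_self (σ : absoluteGaloisGroup F) {z : AlgebraicClosure F} (hz : z ≠ 0) :
    algNorm F (σ • z / z) = 1 := by
  rw [algNorm_div, algNorm_smul, div_self ((algNorm_pos_iff).mpr hz).ne']

/-- **Inertia acts trivially on units modulo `𝔓`**: for `σ ∈ I_F` and `‖w‖ = 1`,
`σ(w)/w ≡ 1 (mod 𝔓)`.  (`‖σ w - w‖ < 1` by the definition of inertia, and `‖w‖ = 1`.)
Ref: Serre, Invent. Math. 15 (1972), §1.3 and §1.7 Remarque; Serre, *Local Fields*, IV §2 Prop. 7.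
[cite: SerreInventiones1972, §1.3] -/
theorem residue_smul_div_self_of_algNorm_eq_one {σ : absoluteGaloisGroup F} (hσ : σ ∈ absInertia F)
    {w : AlgebraicClosure F} (hw : algNorm F w = 1) :
    residue F (σ • w / w) = 1 := by
  have hw0 : w ≠ 0 := (algNorm_pos_iff).mp (by rw [hw]; exact one_pos)
  have h1 : algNorm F (σ • w / w) = 1 := algNorm_smul_div_self σ hw0
  have hres : residue F (σ • w / w) = residue F 1 := by
    rw [residue_eq_residue_iff h1.le algNorm_one.le]
    have hsub : σ • w / w - 1 = (σ • w - w) / w := by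
      field_simp
    rw [hsub, algNorm_div, hw, div_one]
    exact (mem_absInertia_iff_algNorm.mp hσ) w hw.le
  rw [hres, residue_one]

/-- **The action of `I_F` on `z` modulo `𝔓` only depends on `‖z‖`**: for `σ ∈ I_F` and non-zero
`z₁, z₂ ∈ F̄` of the same absolute value, `σ(z₁)/z₁ ≡ σ(z₂)/z₂ (mod 𝔓)` — write `z₁ = w z₂` with
`‖w‖ = 1` and use `σ(w) ≡ w`.  This is the principle behind the independence of `θ_d` of all
choices (Serre 1972, §1.3, §1.7 Prop. 3 and Remarque) and behind §1.8 Prop. 8.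
[cite: SerreInventiones1972, §1.7 Prop. 3 and Remarque] -/
theorem residue_smul_div_eq_of_algNorm_eq {σ : absoluteGaloisGroup F} (hσ : σ ∈ absInertia F)
    {z₁ z₂ : AlgebraicClosure F} (hz₁ : z₁ ≠ 0) (h : algNorm F z₁ = algNorm F z₂) :
    residue F (σ • z₁ / z₁) = residue F (σ • z₂ / z₂) := by
  have hz₂ : z₂ ≠ 0 := by
    intro h0
    rw [h0, (algNorm_eq_zero_iff).mpr rfl, algNorm_eq_zero_iff] at h
    exact hz₁ h
  have hw : algNorm F (z₁ / z₂) = 1 := by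
    rw [algNorm_div, h, div_self ((algNorm_pos_iff).mpr hz₂).ne']
  have hσz₂ : σ • z₂ ≠ 0 := by
    rw [absoluteGaloisGroup.smul_def]; exact (map_ne_zero _).mpr hz₂
  have hfac : σ • z₁ / z₁ = (σ • (z₁ / z₂) / (z₁ / z₂)) * (σ • z₂ / z₂) := by
    simp only [absoluteGaloisGroup.smul_def, map_div₀] at hσz₂ ⊢
    field_simp
  rw [hfac, residue_mul (algNorm_smul_div_self σ (div_ne_zero hz₁ hz₂)).le
    (algNorm_smul_div_self σ hz₂).le, residue_smul_div_self_of_algNorm_eq_one hσ hw, one_mul]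

/-- `‖z‖ ^ n = ‖a‖` for the chosen root `z = kummerRoot F hn a` of `z ^ n = a`. [folklore] -/
theorem algNorm_kummerRoot_pow {n : ℕ} (hn : 0 < n) (a : 𝒪[F]) :
    algNorm F (kummerRoot F hn a : AlgebraicClosure F) ^ n =
      algNorm F (algebraMap 𝒪[F] (AlgebraicClosure F) a) := by
  rw [← algNorm_pow, coe_kummerRoot_pow]

/-- **The Kummer character through any element of the right absolute value.**  For `σ ∈ I_F`, the
Kummer character of `a ≠ 0` (defined with the chosen root of `z ^ n = a`) satisfies
`θ(σ) = ι(σ(z)/z mod 𝔓)` for every `z ∈ F̄ˣ` with `‖z‖ ^ n = ‖a‖`.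
Ref: Serre, Invent. Math. 15 (1972), §1.7, Prop. 3 and Remarque (independence of the choices).
[cite: SerreInventiones1972, §1.7 Prop. 3] -/
theorem coe_kummerCharacter_eq_residue_smul_div {k : Type v} [Field k] {n : ℕ} (hn : 0 < n)
    {a : 𝒪[F]} (ha : a ≠ 0) (ι : absIntegers 𝒪[F] F ⧸ absMaximalIdeal F →+* k) (σ : absInertia F)
    {z : AlgebraicClosure F}
    (hnorm : algNorm F z ^ n = algNorm F (algebraMap 𝒪[F] (AlgebraicClosure F) a)) :
    (kummerCharacter F hn ha ι σ : k) = ι (residue F ((σ : absoluteGaloisGroup F) • z / z)) := by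
  rw [coe_kummerCharacter_apply, ← residue_coe, coe_kummerCocycleInt]
  congr 1
  change residue F ((σ : absoluteGaloisGroup F) • (kummerRoot F hn a : AlgebraicClosure F) /
    kummerRoot F hn a) = _
  refine residue_smul_div_eq_of_algNorm_eq σ.2 (coe_kummerRoot_ne_zero hn ha) ?_
  have h1 : algNorm F (kummerRoot F hn a : AlgebraicClosure F) ^ n = algNorm F z ^ n := by
    rw [algNorm_kummerRoot_pow, hnorm]
  exact (pow_left_inj₀ (algNorm_nonneg _) (algNorm_nonneg _) hn.ne').mp h1

end Valuation

/-! ### Primitive `p`-th roots of unity over a field with uniformiser `p` -/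

section Cyclotomic

variable {p : ℕ} [hp : Fact p.Prime]

omit [TopologicalSpace F] [IsNonarchimedeanLocalField F] hp in
/-- If `p` is a uniformiser of `𝒪[F]` then `p ≠ 0` in `F` (so `F` has characteristic `0` or
prime to `p`, and `F̄` contains the `p`-th roots of unity). [folklore] -/
theorem neZero_natCast_of_irreducible (hirr : Irreducible (p : 𝒪[F])) : NeZero ((p : ℕ) : F) := by
  refine ⟨fun h => hirr.ne_zero (Subtype.ext ?_)⟩
  simpa using h

omit hp in
/-- `‖p‖ < 1` in `F̄` when `p` is a uniformiser of `𝒪[F]`. [folklore] -/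
theorem algNorm_natCast_lt_one (hirr : Irreducible (p : 𝒪[F])) :
    algNorm F ((p : ℕ) : AlgebraicClosure F) < 1 := by
  have h := algNorm_uniformizer_lt_one hirr
  rwa [map_natCast] at h

/-- A root of unity has absolute value `1`. [folklore] -/
theorem algNorm_eq_one_of_pow_eq_one {ζ : AlgebraicClosure F} {m : ℕ} (hm : m ≠ 0) (hζ : ζ ^ m = 1) :
    algNorm F ζ = 1 := by
  have h : algNorm F ζ ^ m = 1 ^ m := by
    rw [← algNorm_pow, hζ, one_pow, algNorm_one]
  exact (pow_left_inj₀ (algNorm_nonneg _) zero_le_one hm).mp h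

/-- `‖1 - ζ^j‖ ≤ ‖1 - ζ‖` for `‖ζ‖ ≤ 1` (`1 - ζ^j = (1 - ζ)(1 + ζ + ⋯ + ζ^{j-1})`). [folklore] -/
theorem algNorm_one_sub_pow_le {ζ : AlgebraicClosure F} (hζ : algNorm F ζ ≤ 1) (j : ℕ) :
    algNorm F (1 - ζ ^ j) ≤ algNorm F (1 - ζ) := by
  have hgeom : 1 - ζ ^ j = (1 - ζ) * ∑ i ∈ range j, ζ ^ i := by
    have := mul_geom_sum ζ j
    linear_combination this
  rw [hgeom, algNorm_mul]
  refine mul_le_of_le_one_right (algNorm_nonneg _) (algNorm_sum_le _ _ zero_le_one fun i _ => ?_)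
  rw [algNorm_pow]
  exact pow_le_one₀ (algNorm_nonneg _) hζ

/-- **`‖1 - ζ^j‖ = ‖1 - ζ‖` for a primitive `p`-th root of unity `ζ` and `p ∤ j`** (`ζ^j` is again
a primitive `p`-th root, of which `ζ` is a power).
Ref: Neukirch, *ANT*, Ch. II (7.13) (the `1 - ζ^j` are associated). [cite: NeukirchANT1999, Ch. II (7.13)] -/
theorem algNorm_one_sub_pow_eq {ζ : AlgebraicClosure F} (hζ : IsPrimitiveRoot ζ p) {j : ℕ}
    (hj : ¬ p ∣ j) : algNorm F (1 - ζ ^ j) = algNorm F (1 - ζ) := by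
  have hp0 : p ≠ 0 := hp.out.ne_zero
  have hζ1 : algNorm F ζ ≤ 1 := (algNorm_eq_one_of_pow_eq_one hp0 hζ.pow_eq_one).le
  refine le_antisymm (algNorm_one_sub_pow_le hζ1 j) ?_
  have hζj : IsPrimitiveRoot (ζ ^ j) p :=
    hζ.pow_of_coprime j ((Nat.Prime.coprime_iff_not_dvd hp.out).mpr hj).symm
  obtain ⟨i, -, hi⟩ := hζj.eq_pow_of_pow_eq_one hζ.pow_eq_one
  have hζj1 : algNorm F (ζ ^ j) ≤ 1 := by
    rw [algNorm_pow]; exact pow_le_one₀ (algNorm_nonneg _) hζ1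
  calc algNorm F (1 - ζ) = algNorm F (1 - (ζ ^ j) ^ i) := by rw [hi]
    _ ≤ algNorm F (1 - ζ ^ j) := algNorm_one_sub_pow_le hζj1 i

/-- **`‖1 - ζ‖ ^ (p - 1) = ‖p‖`** for a primitive `p`-th root of unity `ζ ∈ F̄`:
`∏_{0<j<p} (1 - ζ^j) = Φ_p(1) = p` (Mathlib `IsPrimitiveRoot.prod_one_sub_pow_eq_order`) and all
factors have the absolute value of `1 - ζ`.
Ref: Neukirch, *ANT*, Ch. II (7.13) (`p = ∏ (1 - ζ^j)`, `1 - ζ` a uniformiser of `ℚ_p(ζ)` with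
`e = p - 1`). [cite: NeukirchANT1999, Ch. II (7.13)] -/
theorem algNorm_one_sub_primitiveRoot_pow {ζ : AlgebraicClosure F} (hζ : IsPrimitiveRoot ζ p) :
    algNorm F (1 - ζ) ^ (p - 1) = algNorm F ((p : ℕ) : AlgebraicClosure F) := by
  have hp1 : p - 1 + 1 = p := Nat.sub_add_cancel hp.out.one_le
  have hζ' : IsPrimitiveRoot ζ (p - 1 + 1) := by rwa [hp1]
  have hprod := hζ'.prod_one_sub_pow_eq_order
  have hcast : ((p - 1 : ℕ) : AlgebraicClosure F) + 1 = ((p : ℕ) : AlgebraicClosure F) := by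
    have h := congrArg (fun n : ℕ => (n : AlgebraicClosure F)) hp1
    simpa only [Nat.cast_add, Nat.cast_one] using h
  rw [hcast] at hprod
  rw [← hprod]
  -- `‖∏ (1 - ζ^{j+1})‖ = ∏ ‖1 - ζ^{j+1}‖ = ‖1 - ζ‖ ^ (p-1)`
  have hmul : algNorm F (∏ j ∈ range (p - 1), (1 - ζ ^ (j + 1))) =
      ∏ j ∈ range (p - 1), algNorm F (1 - ζ ^ (j + 1)) := by
    classical
    induction (range (p - 1)) using Finset.induction_on with
    | empty => rw [prod_empty, prod_empty, algNorm_one]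
    | insert a s ha ih => rw [prod_insert ha, prod_insert ha, algNorm_mul, ih]
  rw [hmul, ← Finset.card_range (p - 1), ← prod_const, Finset.card_range]
  refine (prod_congr rfl fun j hj => algNorm_one_sub_pow_eq hζ fun hdvd => ?_).symm
  have hjlt : j + 1 < p := by
    have := mem_range.mp hj
    omega
  exact absurd (Nat.le_of_dvd (Nat.succ_pos j) hdvd) (not_le.mpr hjlt)

/-- **`ζ ≡ 1 (mod 𝔓)`**: `‖ζ - 1‖ < 1` for a primitive `p`-th root of unity `ζ ∈ F̄` when `p` is a
uniformiser of `𝒪[F]` (`‖1 - ζ‖^{p-1} = ‖p‖ < 1`).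
Ref: Serre, Invent. Math. 15 (1972), §1.8 (proof of Prop. 8). [cite: SerreInventiones1972, §1.8] -/
theorem algNorm_primitiveRoot_sub_one_lt_one (hirr : Irreducible (p : 𝒪[F])) {ζ : AlgebraicClosure F}
    (hζ : IsPrimitiveRoot ζ p) : algNorm F (ζ - 1) < 1 := by
  have h := algNorm_one_sub_primitiveRoot_pow (F := F) hζ
  have hlt : algNorm F (1 - ζ) ^ (p - 1) < 1 := by rw [h]; exact algNorm_natCast_lt_one hirr
  have hp1 : p - 1 ≠ 0 := by have := hp.out.two_le; omega
  rw [← algNorm_neg, neg_sub]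
  by_contra hge
  rw [not_lt] at hge
  exact absurd (one_le_pow₀ (M₀ := ℝ) hge (n := p - 1)) (not_le.mpr hlt)

/-- **`σ(ζ - 1)/(ζ - 1) ≡ a (mod 𝔓)` when `σ ζ = ζ ^ a`**, for a primitive `p`-th root of unity
`ζ ∈ F̄` and `p` a uniformiser: `(ζ^a - 1)/(ζ - 1) = 1 + ζ + ⋯ + ζ^{a-1}` and `ζ ≡ 1`.
Ref: Serre, Invent. Math. 15 (1972), §1.8 (proof of Prop. 8: `χ` mod `𝔓` through `ζ - 1`).
[cite: SerreInventiones1972, §1.8 Prop. 8 (proof)] -/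
theorem residue_smul_sub_one_div (hirr : Irreducible (p : 𝒪[F])) {ζ : AlgebraicClosure F}
    (hζ : IsPrimitiveRoot ζ p) (σ : absoluteGaloisGroup F) {a : ℕ} (ha : σ • ζ = ζ ^ a) :
    residue F (σ • (ζ - 1) / (ζ - 1)) = (a : absIntegers 𝒪[F] F ⧸ absMaximalIdeal F) := by
  have hp0 : p ≠ 0 := hp.out.ne_zero
  have hζ1 : algNorm F ζ ≤ 1 := (algNorm_eq_one_of_pow_eq_one hp0 hζ.pow_eq_one).le
  have hζne : ζ ≠ 1 := hζ.ne_one hp.out.one_lt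
  have hz0 : ζ - 1 ≠ 0 := sub_ne_zero.mpr hζne
  -- `σ(ζ - 1)/(ζ - 1) = ∑_{i<a} ζ^i`
  have hσ : σ • (ζ - 1) = ζ ^ a - 1 := by
    rw [smul_sub, ha, smul_one]
  have hquot : σ • (ζ - 1) / (ζ - 1) = ∑ i ∈ range a, ζ ^ i := by
    rw [hσ, div_eq_iff hz0, geom_sum_mul]
  rw [hquot, residue_sum _ _ fun i _ => by rw [algNorm_pow]; exact pow_le_one₀ (algNorm_nonneg _) hζ1]
  -- each `ζ^i ≡ 1`
  have hterm : ∀ i, residue F (ζ ^ i) = 1 := by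
    intro i
    rw [← residue_one (F := F),
      residue_eq_residue_iff (by rw [algNorm_pow]; exact pow_le_one₀ (algNorm_nonneg _) hζ1)
        algNorm_one.le, ← algNorm_neg, neg_sub]
    calc algNorm F (1 - ζ ^ i) ≤ algNorm F (1 - ζ) := algNorm_one_sub_pow_le hζ1 i
      _ < 1 := by rw [← neg_sub, algNorm_neg]; exact algNorm_primitiveRoot_sub_one_lt_one hirr hζ
  simp_rw [hterm]
  rw [sum_const, card_range, nsmul_eq_mul, mul_one]

end Cyclotomic

/-! ### Serre 1972, §1.8, Corollary of Prop. 8: `ψ₁ = χ̄_p` on `I_F` when `e = 1` -/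

section Main

variable {k : Type v} [Field k] [TopologicalSpace k] [IsTopologicalRing k]
variable {p : ℕ} [hp : Fact p.Prime]

/-- **Serre 1972, §1.8, Cor. of Prop. 8 (`e = 1`: `θ_{p-1} = χ`).**  Let `F` be a non-archimedean
local field whose residue field is `𝔽_p` and in which `p` is a uniformiser (absolute ramification
index `e = 1`, e.g. `F = ℚ_p`).  Then on the inertia group `I_F` the level-one fundamental
character `ψ₁` (the Kummer character of `z ^ (p-1) = p`) coincides with the mod `p` cyclotomic
character `χ̄_p`, both pushed into `k` (along `ι : S ⧸ 𝔓 → k` and `ι' : 𝔽_p → k`; the two sides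
are the images of the same integer `a` with `σ ζ = ζ^a`).  Proof: `θ_{p-1}(σ) ≡ σ(z)/z` may be
computed on any `z'` with `‖z'‖ = ‖z‖` (`coe_kummerCharacter_eq_residue_smul_div`); `z' = ζ - 1`
qualifies, `‖ζ - 1‖^{p-1} = ‖p‖` (`algNorm_one_sub_primitiveRoot_pow`), and
`σ(ζ - 1)/(ζ - 1) ≡ a` (`residue_smul_sub_one_div`).  Serre: "Cor. — Si `e = 1`, on a
`θ_{p-1} = χ`"; Serre 1987, §2.1: for `ℚ_p` the fundamental character of level `1` is the
restriction to `I` of the cyclotomic character `χ`.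
[cite: SerreInventiones1972, §1.8 Prop. 8 and Cor.] [cite: Serre1987, §2.1] -/
theorem coe_fundamentalCharacter_one_eq_modPCyclotomicCharacter [NeZero ((p : ℕ) : F)]
    (hirr : Irreducible (p : 𝒪[F])) (hq : residueFieldCard F = p)
    (ι : absIntegers 𝒪[F] F ⧸ absMaximalIdeal F →+* k) (ι' : ZMod p →+* k) (σ : absInertia F) :
    (fundamentalCharacter F 1 ι (p : 𝒪[F]) hirr σ : k) =
      (modPCyclotomicCharacter F k p ι' (σ : absoluteGaloisGroup F) : k) := by
  -- a primitive `p`-th root of unity `ζ ∈ F̄` and the exponent `a` with `σ ζ = ζ ^ a`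
  obtain ⟨ζ, hζ⟩ := HasEnoughRootsOfUnity.exists_primitiveRoot (AlgebraicClosure F) p
  set a : ZMod p := (modPCyclotomicCharacterZMod F p (σ : absoluteGaloisGroup F) : ZMod p) with ha
  have hσζ : (σ : absoluteGaloisGroup F) • ζ = ζ ^ a.val :=
    modPCyclotomicCharacterZMod_spec F p _ ζ hζ.pow_eq_one
  -- right-hand side: `ι' a = a.val`
  have hrhs : (modPCyclotomicCharacter F k p ι' (σ : absoluteGaloisGroup F) : k) = (a.val : k) := by
    rw [coe_modPCyclotomicCharacter_apply, ← ha]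
    conv_lhs => rw [← ZMod.natCast_zmod_val a]
    rw [map_natCast]
  -- left-hand side through `z' = ζ - 1`
  have hn : 0 < residueFieldCard F ^ 1 - 1 := residueFieldCard_pow_sub_one_pos F one_ne_zero
  have hexp : residueFieldCard F ^ 1 - 1 = p - 1 := by rw [pow_one, hq]
  have hnorm : algNorm F (ζ - 1) ^ (residueFieldCard F ^ 1 - 1) =
      algNorm F (algebraMap 𝒪[F] (AlgebraicClosure F) (p : 𝒪[F])) := by
    rw [hexp, ← algNorm_neg, neg_sub, algNorm_one_sub_primitiveRoot_pow hζ, map_natCast]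
  have hlhs : (fundamentalCharacter F 1 ι (p : 𝒪[F]) hirr σ : k) = (a.val : k) := by
    rw [fundamentalCharacter_of_ne_zero F one_ne_zero,
      coe_kummerCharacter_eq_residue_smul_div hn hirr.ne_zero ι σ hnorm,
      residue_smul_sub_one_div hirr hζ _ hσζ, map_natCast]
  rw [hlhs, hrhs]

/-- The same with an arbitrary uniformiser `ϖ` (`ψ₁` does not depend on it,
`fundamentalCharacter_eq_holds`). [cite: SerreInventiones1972, §1.8 Prop. 8 and Cor.] -/
theorem coe_fundamentalCharacter_one_eq_modPCyclotomicCharacter' [NeZero ((p : ℕ) : F)]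
    (hirr : Irreducible (p : 𝒪[F])) (hq : residueFieldCard F = p)
    (ι : absIntegers 𝒪[F] F ⧸ absMaximalIdeal F →+* k) (ι' : ZMod p →+* k)
    {ϖ : 𝒪[F]} (hϖ : Irreducible ϖ) (σ : absInertia F) :
    (fundamentalCharacter F 1 ι ϖ hϖ σ : k) =
      (modPCyclotomicCharacter F k p ι' (σ : absoluteGaloisGroup F) : k) := by
  rw [fundamentalCharacter_eq_holds F 1 ι ϖ (p : 𝒪[F]) hϖ hirr]
  exact coe_fundamentalCharacter_one_eq_modPCyclotomicCharacter hirr hq ι ι' σ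

/-- **At a local restriction datum** `loc` of a global `ρ̄ : Γ_ℚ → GL₂(k)` (`loc.F ≅ ℚ_p`:
residue field `𝔽_p`, uniformiser `p`): `ψ₁ = χ̄_p` on `I_{loc.F}`.
[cite: SerreInventiones1972, §1.8 Prop. 8 and Cor.] [cite: Serre1987, §2.1] -/
theorem ModPGaloisRep.LocalRestrictionAt.coe_fundamentalCharacter_one_eq_modPCyclotomicCharacter
    {ρ : ModPGaloisRep ℚ k 2} (loc : ModPGaloisRep.LocalRestrictionAt p ρ)
    (ι : absIntegers 𝒪[loc.F] loc.F ⧸ absMaximalIdeal loc.F →+* k) (ι' : ZMod p →+* k)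
    (σ : absInertia loc.F) :
    haveI := neZero_natCast_of_irreducible loc.irreducible_natCast
    (fundamentalCharacter loc.F 1 ι (p : 𝒪[loc.F]) loc.irreducible_natCast σ : k) =
      (modPCyclotomicCharacter loc.F k p ι' (σ : absoluteGaloisGroup loc.F) : k) :=
  haveI := neZero_natCast_of_irreducible loc.irreducible_natCast
  _root_.Literature.NumberTheory.GaloisRepresentations.coe_fundamentalCharacter_one_eq_modPCyclotomicCharacter
    loc.irreducible_natCast loc.residueFieldCard_eq ι ι' σ

end Main

end Literature.NumberTheory.GaloisRepresentations
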